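import Mathlib.Topology.Instances.Matrix
import Literature.Analysis.Fourier.PhaseSymbolRescalingLocal
import Literature.Analysis.Fourier.HyperbolicSymbolLinearEigenvalues
import Literature.Analysis.Matrix.StrictPencilSpectralData
import HarnessLib

/-!
# Phase families with a zeroth-order term, localized in frequency: linear eigenvalues
(hermitean pencils) and non-existence (strictly hyperbolic pencils)

The analytic core of Rauch's linear step [Rauch1986, Proof of Theorem p. 483, last sentence]
in the generality of a ZEROTH-ORDER TERM AT A SINGLE TIME and of a hypothesis LOCALIZED in
frequency. Rauch's multiplier at time `t̄` is `M(ξ) = exp(t̄A₀⁻¹(-Σ A_l iξ_l - B′(ū)))`; its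
dilates are the phase symbols `Nₙ(ξ) = exp(i(n+1)sA(ξ) + E)` of a real-diagonalizable pencil
`A(ξ) = Σ ξⱼAⱼ` (hermitean after conjugation in the symmetrizable branch of Rauch's class, strictly
hyperbolic in the other) with a CONSTANT matrix `E` (from `B′(ū)`) that does not scale away
(`Literature.Barriers.AtomisticToContinuum.rauchSymbol_smul`). Brenner removes lower-order terms
by letting `t → 0`, which needs the multiplier bound for all `0 < t ≤ T` [Brenner1973, Lemma 5.2
p. 97]; at a single time we use instead first-order averaging of the fast phase
(`Literature.Analysis.ODE.norm_exp_phase_add_mul_idem_sub_le`): near a point of smooth spectral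
decomposition `A(ξ) = Σ_b μ_b(ξ)Π_b(ξ)`,

  `exp(i(n+1)sA(ξ) + E) Πₐ(ξ) = e^{i(n+1)sμₐ(ξ)} (exp(E_d(ξ)) Πₐ(ξ) + O(1/(n+1)))`,
  `E_d = Σ_b Π_b E Π_b`,

uniformly on small balls. This is an approximate phase relation with the continuous, nowhere
vanishing amplitude `exp(E_d)Πₐ`, so the localized, approximate form of the rescaling argument
of [BrennerThomeeWahlbin1975, Ch. 5 §1, proof of Lemma 1.1]
(`fderiv_fderiv_apply_eq_zero_of_localizedApproxPhaseBound`, `PhaseSymbolRescalingLocal.lean`)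
makes every branch `μₐ` affine on a ball; affine branches are linear eigenvalues everywhere
(`hasLinearEigenvalues_of_affine_on_ball`). Results:

* `fderiv_fderiv_branch_eq_zero_of_localizedFamily` — the workhorse (one branch, one point,
  abstract smooth spectral data, any `E`);
* `hasLinearEigenvalues_of_localizedFamily` — hermitean `Aⱼ`: a localized phase family in
  `M_p`, `p ≠ 2`, forces linear eigenvalues (Lemma 1.1 of [BrennerThomeeWahlbin1975, Ch. 5 §1]
  with zeroth-order term; spectral data `EigenBranches`);
* `false_of_localizedFamily_of_strictlyHyperbolic` — strictly hyperbolic real pencils with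
  `d, k ≥ 2` carry no such family [Brenner1973, Thm 3.1, Cor 3.1 p. 84] (spectral data
  `exists_strictSpectralData`).

The localized hypothesis — only `θNₙ ∈ M_p` uniformly, for a cut-off `θ = 1` near each
`ξ₁ ≠ 0` — is what Rauch's estimate (5) yields at `p = 1` by Young's inequality, without the
interpolation step "(5) is valid for `Lᵖ`, `1 < p < 2`" [Rauch1986, p. 483]; a global uniform
family (`θ = 1`) is the special case used with `M_T ∈ M_p`.

## References

* [Rauch1986] J. Rauch, Comm. Math. Phys. 106 (1986) 481–484, Proof of Theorem p. 483.
* [BrennerThomeeWahlbin1975] P. Brenner, V. Thomée, L. B. Wahlbin, LNM 434 (1975), Ch. 5 §1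
  Lemma 1.1 and its proof, (1.4)–(1.5); Ch. 1 Thms 2.6–2.8, Cor 5.3.
* [Brenner1973] P. Brenner, Ark. Mat. 11 (1973) 75–101, Thm 3.1 and Cor 3.1 p. 84, Lemma 5.2
  p. 97.
* [Kato1966] T. Kato, *Perturbation Theory for Linear Operators* (1966), Ch. II §1.4, §5.8
  (smooth spectral data; via `EigenvalueBranches.lean`, `StrictPencilSpectralData.lean`).
-/

noncomputable section

open MeasureTheory Complex Real Filter Topology Set Metric Polynomial NormedSpace
open scoped ENNReal NNReal ContDiff Matrix.Norms.Operator

namespace Literature.Analysis.Fourier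

open Literature.Analysis.Matrix Literature.Analysis.ODE Literature.LinearAlgebra.Matrix

variable {d m : ℕ}

/-! ### Entries versus the operator norm -/

section NormHelpers

variable {μ' ν' : Type*} [Fintype μ'] [Fintype ν']

/-- An entry is bounded by the `ℓ^∞`-operator norm of the matrix. [folklore] -/
theorem norm_entry_le_linfty_opNorm (M : Matrix μ' ν' ℂ) (i : μ') (j : ν') : ‖M i j‖ ≤ ‖M‖ := by
  rw [Matrix.linfty_opNorm_def]
  have h1 : ‖M i j‖₊ ≤ ∑ j', ‖M i j'‖₊ :=
    Finset.single_le_sum (f := fun j' => ‖M i j'‖₊) (fun _ _ => zero_le) (Finset.mem_univ j)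
  have h2 : (∑ j', ‖M i j'‖₊) ≤ Finset.univ.sup fun i' => ∑ j', ‖M i' j'‖₊ :=
    Finset.le_sup (f := fun i' => ∑ j', ‖M i' j'‖₊) (Finset.mem_univ i)
  exact_mod_cast h1.trans h2

/-- The `ℓ^∞`-operator norm is bounded by the sum of the norms of the entries. [folklore] -/
theorem linfty_opNorm_le_sum_norm_entry (M : Matrix μ' ν' ℂ) : ‖M‖ ≤ ∑ i, ∑ j, ‖M i j‖ := by
  rw [Matrix.linfty_opNorm_def]
  have h : (Finset.univ.sup fun i => ∑ j, ‖M i j‖₊) ≤ ∑ i, ∑ j, ‖M i j‖₊ :=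
    Finset.sup_le fun i _ =>
      Finset.single_le_sum (f := fun i => ∑ j, ‖M i j‖₊) (fun _ _ => zero_le) (Finset.mem_univ i)
  have h' := NNReal.coe_le_coe.2 h
  push_cast at h'
  exact h'

end NormHelpers

/-- A positive lower bound for finitely many positive reals. [folklore] -/
theorem exists_pos_forall_le {σ : Type*} [Finite σ] (f : σ → ℝ) (hf : ∀ i, 0 < f i) :
    ∃ δ : ℝ, 0 < δ ∧ ∀ i, δ ≤ f i := by
  rcases isEmpty_or_nonempty σ with hσ | hσ
  · exact ⟨1, one_pos, fun i => (IsEmpty.false i).elim⟩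
  · obtain ⟨i₀, hi₀⟩ := Finite.exists_min f
    exact ⟨f i₀, hf i₀, hi₀⟩

/-! ### The workhorse: one branch, one point -/

/-- **Vanishing Hessian of a spectral branch under a localized phase family with zeroth-order
term.** Let `A(ξ) = Σ ξⱼAⱼ` be a complex pencil which on a ball `B = ball ξc r` has the smooth
spectral decomposition `A(ξ) = Σ_b μ_b(ξ)Pr_b(ξ)` (real branches `μ_b`, pairwise distinct,
`C^∞`; complete orthogonal idempotents `Pr_b(ξ) ≠ 0` with `C^∞` entries), let `E` be any matrix,
`s ≠ 0` real, and suppose that near a point `ξ₁ ∈ B` the symbols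
`Nₙ(ξ) = exp(i(n+1)s A(ξ) + E)`, `n = 0, 1, …`, localized by a real cut-off `θ` (`θ = 1` near
`ξ₁`), lie in `M_p` with one constant, `1 ≤ p ≤ ∞`, `p ≠ 2`. Then the Hessian of `s μₐ` at `ξ₁`
vanishes for every branch `a`. Proof: first-order averaging
(`norm_exp_phase_add_mul_idem_sub_le`) gives, uniformly on a small ball around `ξ₁`,
`Nₙ(ξ)Prₐ(ξ) = e^{i(n+1)sμₐ(ξ)}(exp(E_d(ξ))Prₐ(ξ) + O(1/(n+1)))` with
`E_d = Σ_b Pr_b E Pr_b`, which is the approximate phase relation of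
`fderiv_fderiv_apply_eq_zero_of_localizedApproxPhaseBound` with the continuous, nowhere
vanishing amplitude `exp(E_d)Prₐ`. For `E = 0` this is the printed argument of
[BrennerThomeeWahlbin1975, Ch. 5 §1, proof of Lemma 1.1]; the zeroth-order term is the one of
Rauch's multiplier at a single time [Rauch1986, Proof of Theorem p. 483].
[cite: BrennerThomeeWahlbin1975, Ch. 5 §1, proof of Lemma 1.1, (1.4)–(1.5)] -/
theorem fderiv_fderiv_branch_eq_zero_of_localizedFamily {p : ℝ≥0∞} (hp1 : 1 ≤ p) (hp2 : p ≠ 2)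
    {s : ℝ} (hs : s ≠ 0) (A : Fin d → Matrix (Fin m) (Fin m) ℂ) (E : Matrix (Fin m) (Fin m) ℂ)
    {ξc : EuclideanSpace ℝ (Fin d)} {r : ℝ} {q : ℕ}
    {μ : Fin q → EuclideanSpace ℝ (Fin d) → ℝ}
    {Pr : Fin q → EuclideanSpace ℝ (Fin d) → Matrix (Fin m) (Fin m) ℂ}
    (hμ : ∀ b, ContDiffOn ℝ ∞ (μ b) (ball ξc r))
    (hinj : ∀ ξ ∈ ball ξc r, Function.Injective fun b => μ b ξ)
    (hPr : ∀ b i j, ContDiffOn ℝ ∞ (fun ξ => Pr b ξ i j) (ball ξc r))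
    (hcoi : ∀ ξ ∈ ball ξc r, CompleteOrthogonalIdempotents fun b => Pr b ξ)
    (hdec : ∀ ξ ∈ ball ξc r, pencil A ξ = ∑ b, ((μ b ξ : ℝ) : ℂ) • Pr b ξ)
    (hne : ∀ ξ ∈ ball ξc r, ∀ b, Pr b ξ ≠ 0)
    {ξ₁ : EuclideanSpace ℝ (Fin d)} (hξ₁ : ξ₁ ∈ ball ξc r)
    {θ : EuclideanSpace ℝ (Fin d) → ℝ} {C : ℝ≥0} (hθ : ∀ᶠ ξ in 𝓝 ξ₁, θ ξ = 1)
    (hN : ∀ n : ℕ, IsLpMultiplierWith p C (fun ξ => ((θ ξ : ℝ) : ℂ) •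
      exp ((((((n : ℝ) + 1) * s : ℝ) : ℂ) * I) • pencil A ξ + E)))
    (a : Fin q) (v : EuclideanSpace ℝ (Fin d)) :
    fderiv ℝ (fderiv ℝ (fun ξ => s * μ a ξ)) ξ₁ v v = 0 := by
  classical
  -- `m ≠ 0` (else `Prₐ = 0`)
  rcases Nat.eq_zero_or_pos m with hm | hm
  · subst hm
    exact absurd (Subsingleton.elim _ _) (hne ξ₁ hξ₁ a)
  haveI : Nonempty (Fin m) := ⟨⟨0, hm⟩⟩
  have hopen : ball ξc r ∈ 𝓝 ξ₁ := isOpen_ball.mem_nhds hξ₁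
  -- continuity at `ξ₁` of the entries of the projections and of the branches
  have hPrc : ∀ b i j, ContinuousAt (fun ξ => Pr b ξ i j) ξ₁ := fun b i j =>
    ((hPr b i j).continuousOn.continuousWithinAt hξ₁).continuousAt hopen
  have hμc : ∀ b, ContinuousAt (μ b) ξ₁ := fun b =>
    ((hμ b).continuousOn.continuousWithinAt hξ₁).continuousAt hopen
  -- eventual bounds near `ξ₁`
  have hev₁ : ∀ᶠ ξ in 𝓝 ξ₁, ∀ bij : Fin q × Fin m × Fin m,
      ‖Pr bij.1 ξ bij.2.1 bij.2.2‖ < ‖Pr bij.1 ξ₁ bij.2.1 bij.2.2‖ + 1 :=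
    eventually_all.2 fun bij => (hPrc bij.1 bij.2.1 bij.2.2).norm.eventually_lt_const (lt_add_one _)
  have hev₂ : ∀ᶠ ξ in 𝓝 ξ₁, ∀ ab : {ab : Fin q × Fin q // ab.1 ≠ ab.2},
      |μ ab.1.1 ξ₁ - μ ab.1.2 ξ₁| / 2 < |μ ab.1.1 ξ - μ ab.1.2 ξ| := by
    refine eventually_all.2 fun ab => ?_
    have hne0 : μ ab.1.1 ξ₁ - μ ab.1.2 ξ₁ ≠ 0 :=
      sub_ne_zero.2 fun h => ab.2 (hinj ξ₁ hξ₁ h)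
    have hc : ContinuousAt (fun ξ => |μ ab.1.1 ξ - μ ab.1.2 ξ|) ξ₁ :=
      ((hμc ab.1.1).sub (hμc ab.1.2)).abs
    exact hc.eventually_const_lt (half_lt_self (abs_pos.2 hne0))
  have hev₃ : ∀ᶠ ξ in 𝓝 ξ₁, ξ ∈ ball ξc r := hopen
  obtain ⟨ρ, hρ, hball⟩ := Metric.eventually_nhds_iff_ball.1 (hθ.and (hev₁.and (hev₂.and hev₃)))
  have hθ' : ∀ ξ ∈ ball ξ₁ ρ, θ ξ = 1 := fun ξ hξ => (hball ξ hξ).1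
  have hsub : ball ξ₁ ρ ⊆ ball ξc r := fun ξ hξ => (hball ξ hξ).2.2.2
  -- the constants
  obtain ⟨δ₀, hδ₀, hδ₀le⟩ := exists_pos_forall_le
    (fun ab : {ab : Fin q × Fin q // ab.1 ≠ ab.2} => |μ ab.1.1 ξ₁ - μ ab.1.2 ξ₁| / 2)
    (fun ab => half_pos (abs_pos.2 (sub_ne_zero.2 fun h => ab.2 (hinj ξ₁ hξ₁ h))))
  set BP : ℝ := ∑ b : Fin q, ∑ i : Fin m, ∑ j : Fin m, (‖Pr b ξ₁ i j‖ + 1) with hBPdef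
  set BE : ℝ := ‖E‖ with hBEdef
  set δ : ℝ := |s| * δ₀ with hδdef
  have hδ : 0 < δ := mul_pos (abs_pos.2 hs) hδ₀
  -- the phases of the averaging lemma
  set lamv : EuclideanSpace ℝ (Fin d) → Fin q → ℝ := fun ξ b => -(s * μ b ξ) with hlamv
  have hgap : ∀ ξ ∈ ball ξ₁ ρ, ∀ a' b : Fin q, a' ≠ b → δ ≤ |lamv ξ a' - lamv ξ b| := by
    intro ξ hξ a' b hab
    have h1 := (hball ξ hξ).2.2.1 ⟨(a', b), hab⟩
    have h2 := hδ₀le ⟨(a', b), hab⟩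
    dsimp only at h1 h2
    rw [hlamv]
    dsimp only
    rw [show -(s * μ a' ξ) - -(s * μ b ξ) = -(s * (μ a' ξ - μ b ξ)) by ring, abs_neg, abs_mul, hδdef]
    exact mul_le_mul_of_nonneg_left (h2.trans h1.le) (abs_nonneg s)
  have hBP : ∀ ξ ∈ ball ξ₁ ρ, ∀ b, ‖Pr b ξ‖ ≤ BP := by
    intro ξ hξ b
    have h1 := (hball ξ hξ).2.1
    calc ‖Pr b ξ‖ ≤ ∑ i, ∑ j, ‖Pr b ξ i j‖ := linfty_opNorm_le_sum_norm_entry _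
      _ ≤ ∑ i, ∑ j, (‖Pr b ξ₁ i j‖ + 1) :=
          Finset.sum_le_sum fun i _ => Finset.sum_le_sum fun j _ => (h1 (b, i, j)).le
      _ ≤ BP := by
          rw [hBPdef]
          exact Finset.single_le_sum (f := fun b => ∑ i, ∑ j, (‖Pr b ξ₁ i j‖ + 1))
            (fun b _ => Finset.sum_nonneg fun i _ => Finset.sum_nonneg fun j _ => by positivity)
            (Finset.mem_univ b)
  have hBE : ‖E‖ ≤ BE := le_rfl
  -- the symbols and the exponent identity
  set N : ℕ → EuclideanSpace ℝ (Fin d) → Matrix (Fin m) (Fin m) ℂ := fun n ξ =>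
    exp ((((((n : ℝ) + 1) * s : ℝ) : ℂ) * I) • pencil A ξ + E) with hNdef
  have hexpo : ∀ n : ℕ, ∀ ξ ∈ ball ξ₁ ρ,
      (((((n : ℝ) + 1) * s : ℝ) : ℂ) * I) • pencil A ξ + E =
        (∑ b, (-(I * (((n : ℝ) + 1 : ℝ) : ℂ) * (lamv ξ b : ℂ))) • Pr b ξ) + E := by
    intro n ξ hξ
    rw [hdec ξ (hsub hξ), Finset.smul_sum]
    congr 1
    refine Finset.sum_congr rfl fun b _ => ?_
    rw [smul_smul, hlamv]
    congr 1
    push_cast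
    ring
  -- the averaging estimate, uniformly on the small ball
  set Aamp : EuclideanSpace ℝ (Fin d) → Matrix (Fin m) (Fin m) ℂ := fun ξ =>
    exp (idemBlockDiag (fun b => Pr b ξ) E) * Pr a ξ with hAamp
  have havg : ∀ n : ℕ, ∀ ξ ∈ ball ξ₁ ρ,
      ‖N n ξ * Pr a ξ - cexp (I * ((((n : ℝ) + 1) * (s * μ a ξ) : ℝ) : ℂ)) • Aamp ξ‖ ≤
        BP * averagingBound q BP BE δ / ((n : ℝ) + 1) := by
    intro n ξ hξ
    have hn : (0 : ℝ) < (n : ℝ) + 1 := by positivity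
    have key := norm_exp_phase_add_mul_idem_sub_le (hcoi ξ (hsub hξ)) hδ (hgap ξ hξ) (hBP ξ hξ)
      hBE hn a
    have hph : -(I * (((n : ℝ) + 1 : ℝ) : ℂ) * (lamv ξ a : ℂ)) =
        I * ((((n : ℝ) + 1) * (s * μ a ξ) : ℝ) : ℂ) := by
      rw [hlamv]; push_cast; ring
    rw [hNdef, hAamp]
    dsimp only
    rw [hexpo n ξ hξ, ← hph]
    exact key
  have havg0 : 0 ≤ BP * averagingBound q BP BE δ := by
    have h := havg 0 ξ₁ (mem_ball_self hρ)
    have h' : (0 : ℝ) ≤ BP * averagingBound q BP BE δ / ((0 : ℕ) + 1 : ℝ) :=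
      (norm_nonneg _).trans (by exact_mod_cast h)
    simpa using h'
  -- the amplitude is continuous and nowhere zero on the small ball
  have hPrcont : ∀ b, ContinuousOn (Pr b) (ball ξ₁ ρ) := fun b =>
    continuousOn_pi.2 fun i => continuousOn_pi.2 fun j => ((hPr b i j).continuousOn).mono hsub
  have hAcont : ContinuousOn Aamp (ball ξ₁ ρ) := by
    have hd : ContinuousOn (fun ξ => idemBlockDiag (fun b => Pr b ξ) E) (ball ξ₁ ρ) := by
      have : (fun ξ => idemBlockDiag (fun b => Pr b ξ) E) = fun ξ => ∑ b, Pr b ξ * E * Pr b ξ := rfl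
      rw [this]
      exact continuousOn_finsetSum _ fun b _ => ((hPrcont b).mul continuousOn_const).mul (hPrcont b)
    exact (NormedSpace.exp_continuous.comp_continuousOn hd).mul (hPrcont a)
  have hA : ∀ i j, ContinuousOn (fun ξ => Aamp ξ i j) (ball ξ₁ ρ) := fun i j =>
    (continuousOn_pi.1 ((continuousOn_pi.1 hAcont) i)) j
  have hA0 : ∀ ξ ∈ ball ξ₁ ρ, Aamp ξ ≠ 0 := by
    intro ξ hξ h0
    obtain ⟨U, hU⟩ := Matrix.isUnit_exp (idemBlockDiag (fun b => Pr b ξ) E)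
    apply hne ξ (hsub hξ) a
    have : (U : Matrix (Fin m) (Fin m) ℂ) * Pr a ξ = 0 := by rw [hU]; exact h0
    calc Pr a ξ = (↑U⁻¹ : Matrix (Fin m) (Fin m) ℂ) * ((U : Matrix (Fin m) (Fin m) ℂ) * Pr a ξ) := by
          rw [Units.inv_mul_cancel_left]
      _ = 0 := by rw [this, mul_zero]
  -- uniform entrywise bound for `Nₙ Prₐ`
  set Bc : ℝ := Real.exp (q * BP ^ 2 * BE) * BP + BP * averagingBound q BP BE δ with hBcdef
  have hphase1 : ∀ n : ℕ, ∀ ξ, ‖cexp (I * ((((n : ℝ) + 1) * (s * μ a ξ) : ℝ) : ℂ))‖ = 1 :=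
    fun n ξ => by rw [mul_comm I, Complex.norm_exp_ofReal_mul_I]
  have hmain_bd : ∀ ξ ∈ ball ξ₁ ρ, ‖Aamp ξ‖ ≤ Real.exp (q * BP ^ 2 * BE) * BP := by
    intro ξ hξ
    rw [hAamp]
    dsimp only
    have h1 : ‖exp (idemBlockDiag (fun b => Pr b ξ) E)‖ ≤ Real.exp (q * BP ^ 2 * BE) :=
      (Literature.Analysis.ODE.norm_exp_le_exp_norm _).trans (Real.exp_le_exp.2
        ((norm_idemBlockDiag_le (hBP ξ hξ) E).trans (mul_le_mul_of_nonneg_left hBE (by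
          have : 0 ≤ BP := (norm_nonneg _).trans (hBP ξ hξ a)
          positivity))))
    calc ‖exp (idemBlockDiag (fun b => Pr b ξ) E) * Pr a ξ‖
        ≤ ‖exp (idemBlockDiag (fun b => Pr b ξ) E)‖ * ‖Pr a ξ‖ := norm_mul_le _ _
      _ ≤ Real.exp (q * BP ^ 2 * BE) * BP :=
          mul_le_mul h1 (hBP ξ hξ a) (norm_nonneg _) (Real.exp_pos _).le
  have hB : ∀ n : ℕ, ∀ ξ ∈ ball ξ₁ ρ, ∀ i j, ‖(N n ξ * Pr a ξ) i j‖ ≤ Bc := by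
    intro n ξ hξ i j
    refine (norm_entry_le_linfty_opNorm _ i j).trans ?_
    have h1 := havg n ξ hξ
    have h2 : ‖N n ξ * Pr a ξ‖ ≤ ‖cexp (I * ((((n : ℝ) + 1) * (s * μ a ξ) : ℝ) : ℂ)) • Aamp ξ‖ +
        ‖N n ξ * Pr a ξ - cexp (I * ((((n : ℝ) + 1) * (s * μ a ξ) : ℝ) : ℂ)) • Aamp ξ‖ := by
      have := norm_add_le (cexp (I * ((((n : ℝ) + 1) * (s * μ a ξ) : ℝ) : ℂ)) • Aamp ξ)
        (N n ξ * Pr a ξ - cexp (I * ((((n : ℝ) + 1) * (s * μ a ξ) : ℝ) : ℂ)) • Aamp ξ)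
      rwa [add_sub_cancel] at this
    have h3 : ‖cexp (I * ((((n : ℝ) + 1) * (s * μ a ξ) : ℝ) : ℂ)) • Aamp ξ‖ ≤
        Real.exp (q * BP ^ 2 * BE) * BP := by
      rw [norm_smul, hphase1, one_mul]
      exact hmain_bd ξ hξ
    have h4 : BP * averagingBound q BP BE δ / ((n : ℝ) + 1) ≤ BP * averagingBound q BP BE δ :=
      div_le_self havg0 (by simp)
    rw [hBcdef]
    linarith
  -- the approximate phase relation, entrywise and uniformly
  have hNP : ∀ e : ℝ, 0 < e → ∀ᶠ n : ℕ in atTop, ∀ ξ ∈ ball ξ₁ ρ, ∀ i j,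
      ‖(N n ξ * Pr a ξ - cexp (I * ((((n : ℝ) + 1) * (s * μ a ξ) : ℝ) : ℂ)) • Aamp ξ) i j‖ ≤ e := by
    intro e he
    have ht : Tendsto (fun n : ℕ => BP * averagingBound q BP BE δ / ((n : ℝ) + 1)) atTop (𝓝 0) := by
      have := (tendsto_one_div_add_atTop_nhds_zero_nat).const_mul (BP * averagingBound q BP BE δ)
      rw [mul_zero] at this
      refine this.congr fun n => ?_
      ring
    filter_upwards [ht.eventually (gt_mem_nhds he)] with n hn ξ hξ i j
    exact ((norm_entry_le_linfty_opNorm _ i j).trans (havg n ξ hξ)).trans hn.le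
  -- smoothness of the phase and of the projection entries on the small ball
  have hlam : ContDiffOn ℝ ∞ (fun ξ => s * μ a ξ) (ball ξ₁ ρ) :=
    (contDiffOn_const.mul (hμ a)).mono hsub
  have hP : ∀ i j, ContDiffOn ℝ ∞ (fun ξ => Pr a ξ i j) (ball ξ₁ ρ) := fun i j => (hPr a i j).mono hsub
  exact fderiv_fderiv_apply_eq_zero_of_localizedApproxPhaseBound hp1 hp2 hθ' hN hlam hP hA hA0 hB
    hNP (mem_ball_self hρ) v

/-! ### Hermitean pencils: a localized phase family forces linear eigenvalues -/

/-- **Brenner–Thomée–Wahlbin's Lemma 1.1 with a zeroth-order term and localized hypothesis.**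
Let `A₁, …, A_d` be hermitean, `E` any matrix, `s ≠ 0` real, `1 ≤ p ≤ ∞`, `p ≠ 2`. If for every
`ξ₁ ≠ 0` the symbols `exp(i(n+1)sA(ξ) + E)`, `n = 0, 1, …`, localized by some real cut-off `θ`
with `θ = 1` near `ξ₁`, lie in `M_p` with one constant, then the eigenvalues of `A(ξ) = Σ ξⱼAⱼ`
are real linear functions of `ξ` (`HasLinearEigenvalues A`). Proof: on a ball of smooth spectral
decomposition (`EigenBranches`, [Kato1966, Ch. II §5]) avoiding the origin, every branch has
vanishing Hessian (`fderiv_fderiv_branch_eq_zero_of_localizedFamily`), hence is affine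
(`exists_affine_of_fderiv_fderiv_apply_eq_zero`), and affine branches on a ball are linear
eigenvalues everywhere by analyticity and homogeneity (`hasLinearEigenvalues_of_affine_on_ball`),
as in the printed proof. For `E = 0` and `θ = 1` this is the tree's
`hasLinearEigenvalues_of_uniform_exp_family`.
[cite: BrennerThomeeWahlbin1975, Ch. 5 §1 Lemma 1.1 and its proof, (1.4)–(1.5)] -/
theorem hasLinearEigenvalues_of_localizedFamily {A : Fin d → Matrix (Fin m) (Fin m) ℂ}
    (hA : ∀ j, (A j).IsHermitian) {p : ℝ≥0∞} (hp1 : 1 ≤ p) (hp2 : p ≠ 2) {s : ℝ} (hs : s ≠ 0)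
    (E : Matrix (Fin m) (Fin m) ℂ)
    (hloc : ∀ ξ₁ : EuclideanSpace ℝ (Fin d), ξ₁ ≠ 0 →
      ∃ (θ : EuclideanSpace ℝ (Fin d) → ℝ) (C : ℝ≥0), (∀ᶠ ξ in 𝓝 ξ₁, θ ξ = 1) ∧
        ∀ n : ℕ, IsLpMultiplierWith p C (fun ξ => ((θ ξ : ℝ) : ℂ) •
          exp ((((((n : ℝ) + 1) * s : ℝ) : ℂ) * I) • pencil A ξ + E))) :
    HasLinearEigenvalues A := by
  classical
  obtain ⟨Eb⟩ := nonempty_eigenBranches hA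
  rcases Nat.eq_zero_or_pos d with hd | hd
  · -- `d = 0`: the ball is a point and every branch is constant (affine) there
    subst hd
    refine hasLinearEigenvalues_of_affine_on_ball A
      (fun _ => (0 : EuclideanSpace ℝ (Fin 0) →L[ℝ] ℝ)) (fun i => Eb.branch i Eb.center) Eb.mult
      (ξ₀ := Eb.center) Eb.radius_pos fun ξ hξ => ?_
    have hξ0 : ξ = Eb.center := PiLp.ext fun i => Fin.elim0 i
    rw [Eb.charpoly_eq hξ]
    refine Finset.prod_congr rfl fun i _ => ?_
    rw [hξ0]
    simp
  · -- a point `c₁ ≠ 0` of the ball of spectral decomposition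
    obtain ⟨c₁, hc₁, hc₁0⟩ : ∃ c₁ ∈ Eb.dom, c₁ ≠ 0 := by
      by_cases h0 : Eb.center = 0
      · have hr := Eb.radius_pos
        refine ⟨EuclideanSpace.single ⟨0, hd⟩ (Eb.radius / 2), ?_, ?_⟩
        · have hn : ‖EuclideanSpace.single (⟨0, hd⟩ : Fin d) (Eb.radius / 2)‖ = Eb.radius / 2 := by
            simp
            linarith
          rw [mem_ball, h0, dist_zero_right, hn]
          linarith
        · exact fun h => (half_pos hr).ne' ((PiLp.single_eq_zero_iff 2 _).1 h)
      · exact ⟨Eb.center, Eb.center_mem, h0⟩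
    -- a sub-ball around `c₁` inside the ball of spectral decomposition and avoiding `0`
    set r₁ : ℝ := min (Eb.radius - dist c₁ Eb.center) ‖c₁‖ with hr₁
    have hr₁pos : 0 < r₁ := lt_min (sub_pos.2 (mem_ball.1 hc₁)) (norm_pos_iff.2 hc₁0)
    have hsub : ball c₁ r₁ ⊆ Eb.dom := fun ξ hξ => by
      rw [mem_ball]
      calc dist ξ Eb.center ≤ dist ξ c₁ + dist c₁ Eb.center := dist_triangle _ _ _
        _ < r₁ + dist c₁ Eb.center := by gcongr; exact mem_ball.1 hξ
        _ ≤ (Eb.radius - dist c₁ Eb.center) + dist c₁ Eb.center := by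
            gcongr; exact min_le_left _ _
        _ = Eb.radius := by ring
    have hne0 : ∀ ξ ∈ ball c₁ r₁, ξ ≠ 0 := by
      intro ξ hξ h0
      rw [h0, mem_ball, dist_comm, dist_zero_right] at hξ
      exact lt_irrefl _ (hξ.trans_le (min_le_right _ _))
    -- every branch is affine on the sub-ball
    have haff : ∀ i : Fin Eb.count, ∃ (L : EuclideanSpace ℝ (Fin d) →L[ℝ] ℝ) (c : ℝ),
        ∀ ξ ∈ ball c₁ r₁, Eb.branch i ξ = L ξ + c := by
      intro i
      have hlam : ContDiffOn ℝ ∞ (fun ξ => s * Eb.branch i ξ) (ball c₁ r₁) :=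
        (contDiffOn_const.mul (Eb.contDiffOn_infty i)).mono hsub
      have h0 : ∀ ξ₁ ∈ ball c₁ r₁, ∀ v,
          fderiv ℝ (fderiv ℝ (fun ξ => s * Eb.branch i ξ)) ξ₁ v v = 0 := by
        intro ξ₁ hξ₁ v
        obtain ⟨θ, C, hθ, hN⟩ := hloc ξ₁ (hne0 ξ₁ hξ₁)
        exact fderiv_fderiv_branch_eq_zero_of_localizedFamily hp1 hp2 hs A E
          (fun b => Eb.contDiffOn_infty b) Eb.injective (fun b => Eb.contDiffOn_proj_apply b)
          (fun ξ hξ => Eb.completeOrthogonalIdempotents_proj hξ)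
          (fun ξ hξ => Eb.pencil_eq_sum_smul_proj hξ) (fun ξ hξ b => Eb.proj_ne_zero hξ b)
          (hsub hξ₁) hθ hN i v
      obtain ⟨L, c, hLc⟩ := exists_affine_of_fderiv_fderiv_apply_eq_zero hr₁pos hlam h0
      refine ⟨s⁻¹ • L, s⁻¹ * c, fun ξ hξ => ?_⟩
      have h := hLc ξ hξ
      rw [FunLike.coe_smul, Pi.smul_apply, smul_eq_mul, ← mul_add, ← h, ← mul_assoc,
        inv_mul_cancel₀ hs, one_mul]
    choose L c hLc using haff
    refine hasLinearEigenvalues_of_affine_on_ball A L c Eb.mult (ξ₀ := c₁) hr₁pos fun ξ hξ => ?_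
    rw [Eb.charpoly_eq (hsub hξ)]
    exact Finset.prod_congr rfl fun i _ => by rw [hLc i ξ hξ]

/-! ### Strictly hyperbolic pencils: no localized phase family -/

/-- **A strictly hyperbolic pencil in `d ≥ 2` variables of size `k ≥ 2` carries no localized
phase family in `M_p`, `p ≠ 2`, with or without zeroth-order term** [Brenner1973, Thm 3.1 and
Cor 3.1]: on the ball of smooth simple branches near `ξ⁰ ≠ 0` (`exists_strictSpectralData`) the
branches would have vanishing Hessian (`fderiv_fderiv_branch_eq_zero_of_localizedFamily`), hence
be affine, hence the eigenvalues linear (`hasLinearEigenvalues_of_affine_on_ball`), which is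
impossible (`IsStrictlyHyperbolicPencil.not_hasLinearEigenvalues`): "linear hyperbolic systems
in dimension greater than one are not well posed in `Lᵖ` for `p ≠ 2`".
[cite: Brenner1973, Thm 3.1 and Cor 3.1 p. 84; Rauch1986, p. 481] -/
theorem false_of_localizedFamily_of_strictlyHyperbolic {K : Fin d → Matrix (Fin m) (Fin m) ℝ}
    (hK : IsStrictlyHyperbolicPencil K) (hd : 2 ≤ d) (hk : 2 ≤ m) {p : ℝ≥0∞} (hp1 : 1 ≤ p)
    (hp2 : p ≠ 2) {s : ℝ} (hs : s ≠ 0) (E : Matrix (Fin m) (Fin m) ℂ)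
    (hloc : ∀ ξ₁ : EuclideanSpace ℝ (Fin d), ξ₁ ≠ 0 →
      ∃ (θ : EuclideanSpace ℝ (Fin d) → ℝ) (C : ℝ≥0), (∀ᶠ ξ in 𝓝 ξ₁, θ ξ = 1) ∧
        ∀ n : ℕ, IsLpMultiplierWith p C (fun ξ => ((θ ξ : ℝ) : ℂ) •
          exp ((((((n : ℝ) + 1) * s : ℝ) : ℂ) * I) •
            pencil (fun j => (K j).map (algebraMap ℝ ℂ)) ξ + E))) : False := by
  classical
  set A : Fin d → Matrix (Fin m) (Fin m) ℂ := fun j => (K j).map (algebraMap ℝ ℂ) with hA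
  -- a base point `ξ⁰ ≠ 0` and the smooth spectral data there
  set ξ₀ : EuclideanSpace ℝ (Fin d) := EuclideanSpace.single ⟨0, by omega⟩ (1 : ℝ) with hξ₀
  have hξ₀0 : ξ₀ ≠ 0 := fun h0 => one_ne_zero ((PiLp.single_eq_zero_iff 2 _).1 h0)
  obtain ⟨ρ, hρ, μ, hsmooth, hinj, hchar, hproj⟩ := exists_strictSpectralData hK hξ₀0
  have hinjR : ∀ ξ ∈ ball ξ₀ ρ, Function.Injective fun b => μ b ξ := by
    intro ξ hξ a b h
    refine hinj ξ hξ ?_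
    simp only at h ⊢
    rw [h]
  -- a sub-ball avoiding `0`
  set r₁ : ℝ := min ρ ‖ξ₀‖ with hr₁
  have hr₁pos : 0 < r₁ := lt_min hρ (norm_pos_iff.2 hξ₀0)
  have hsub : ball ξ₀ r₁ ⊆ ball ξ₀ ρ := ball_subset_ball (min_le_left _ _)
  have hne0 : ∀ ξ ∈ ball ξ₀ r₁, ξ ≠ 0 := by
    intro ξ hξ h0
    rw [h0, mem_ball, dist_comm, dist_zero_right] at hξ
    exact lt_irrefl _ (hξ.trans_le (min_le_right _ _))
  -- every branch is affine on the sub-ball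
  have haff : ∀ a : Fin m, ∃ (L : EuclideanSpace ℝ (Fin d) →L[ℝ] ℝ) (c : ℝ),
      ∀ ξ ∈ ball ξ₀ r₁, μ a ξ = L ξ + c := by
    intro a
    have hlam : ContDiffOn ℝ ∞ (fun ξ => s * μ a ξ) (ball ξ₀ r₁) :=
      (contDiffOn_const.mul (hsmooth a)).mono hsub
    have h0 : ∀ ξ₁ ∈ ball ξ₀ r₁, ∀ v, fderiv ℝ (fderiv ℝ (fun ξ => s * μ a ξ)) ξ₁ v v = 0 := by
      intro ξ₁ hξ₁ v
      obtain ⟨θ, C, hθ, hN⟩ := hloc ξ₁ (hne0 ξ₁ hξ₁)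
      exact fderiv_fderiv_branch_eq_zero_of_localizedFamily hp1 hp2 hs A E
        (Pr := fun b ξ => lagrangeProj (pencil A ξ) (fun b' => ((μ b' ξ : ℝ) : ℂ)) b)
        hsmooth hinjR hproj
        (fun ξ hξ => completeOrthogonalIdempotents_lagrangeProj (hinj ξ hξ) (hchar ξ hξ))
        (fun ξ hξ => eq_sum_smul_lagrangeProj (hinj ξ hξ) (hchar ξ hξ))
        (fun ξ hξ b => lagrangeProj_ne_zero (hinj ξ hξ) (hchar ξ hξ) b)
        (hsub hξ₁) hθ hN a v
    obtain ⟨L, c, hLc⟩ := exists_affine_of_fderiv_fderiv_apply_eq_zero hr₁pos hlam h0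
    refine ⟨s⁻¹ • L, s⁻¹ * c, fun ξ hξ => ?_⟩
    have h := hLc ξ hξ
    rw [FunLike.coe_smul, Pi.smul_apply, smul_eq_mul, ← mul_add, ← h, ← mul_assoc,
      inv_mul_cancel₀ hs, one_mul]
  choose L c hLc using haff
  -- hence linear eigenvalues, contradicting strict hyperbolicity
  have hlin : HasLinearEigenvalues A := by
    refine hasLinearEigenvalues_of_affine_on_ball A L c (fun _ => 1) (ξ₀ := ξ₀) hr₁pos
      fun ξ hξ => ?_
    rw [hchar ξ (hsub hξ)]
    exact Finset.prod_congr rfl fun a _ => by rw [pow_one, hLc a ξ hξ]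
  exact hK.not_hasLinearEigenvalues hd hk hlin

end Literature.Analysis.Fourier

end
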